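import Mathlib
import HarnessLib
import Literature.Analysis.FluidPDE.ClassicalSolution
import Literature.Analysis.FluidPDE.VectorCalculus
import Summits.NavierStokesRegularity.NavierStokesRegularity.Theses.UnthreadedRigidityDoor
import Summits.NavierStokesRegularity.NavierStokesRegularity.Theorems.UnthreadedRigidityDoorUnthreadedRigidityProfileHornShellZero
import Summits.NavierStokesRegularity.NavierStokesRegularity.Theorems.UnthreadedRigidityDoorUnthreadedRigidityProfileHornCompositions
import Summits.NavierStokesRegularity.NavierStokesRegularity.Theorems.UnthreadedRigidityDoorUnthreadedRigidityVirialHornNondegeneracy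
import Summits.NavierStokesRegularity.NavierStokesRegularity.Theorems.UnthreadedRigidityDoorUnthreadedRigidityVirialHornZonal

/-!
# Route `UnthreadedRigidityDoor`, item `UnthreadedRigidity` (W2, stmt-NavierStokesRegularity-27585) — LINE g11-1 «VIRIAL HORN»:
# the kernel-checked COMPOSITIONS BY NAME, with the supports S-V, S-A, S-Z discharged

Prover file (W2 Lean hand ns-crc-p1 g7, DIRECTOR-NS KEY-NS #188 (1); `--supports stmt-NavierStokesRegularity-27585 --as helper`) for LINE g11-1
«VIRIAL HORN» of planner ns-idea-6 g11 (idea-crit-4 g7 PASS, RUNG line, 2026-08-29T03:44Z; sketch sha16 046ceb385f972470; objects BY NAME in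
`Theorems/UnthreadedRigidityDoorUnthreadedRigidityVirialHornDefs.lean`).

The sketch's `sepShellL_null` and its three compositions VERBATIM against the tree objects (`separableOrderTwoRigidityL_of_virial`: V ∧ S-V ∧ S-C ∧
S-Z ⇒ the slice rung in every degree; `isotypicWindowRigidityL_of_crux`: the window rung is a restriction of the crux; `isotypicWindowRigidityL_of_virial`:
W ∧ S-A ∧ V-W ∧ S-V ∧ S-C ∧ S-Z ∧ S-U ⇒ the window rung), the bookkeeping lemmas `isSliceAxisymmetric_of_eq_zero` / `curl_zero_field` being the
landed PROFILE HORN ones; and — new, from `virialNondegeneracy_holds` (S-V), `analyticWedgeSeparableL_holds` (S-A), `zonalShellAxisym_holds` (S-Z) —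
`separableOrderTwoRigidityL_of_identity : OrderTwoVirialIdentity → AngularLemma → SeparableOrderTwoRigidityL` and
`isotypicWindowRigidityL_of_bridges : 1 ≤ l → WindowWedgeAnalyticL → VirialWindowSilence → AngularLemma → WindowAxisUniform → IsotypicWindowRigidityL l n`:
after this file the rungs of the line wait only on the bridges V / W / V-W (M–L) and the S–M supports S-C `AngularLemma`, S-U `WindowAxisUniform`.

HONEST LABEL: plumbing of a RUNG line about SPECIAL separable/isotypic data; `UnthreadedRigidity` (27585), W2 and NS regularity remain OPEN;
nothing here is a statement about the Navier–Stokes equations; nobody here claims `UnthreadedRigidity`.  0 kit.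
-/

-- the summit and its single sub-problem share the name (CONVENTIONS §1), as in every Theorems file
set_option linter.dupNamespace false

namespace Summit.NavierStokesRegularity.NavierStokesRegularity.Theorems.UnthreadedRigidity.VirialHorn

open scoped Topology
open Filter Set
open Summit.NavierStokesRegularity.NavierStokesRegularity.Theorems.UnthreadedRigidity.ProfileHorn (E3 threadingFlux IsSliceAxisymmetric isSliceAxisymmetric_of_eq_zero curl_zero_field)

/-- the null profile gives the zero shell. -/
lemma sepShellL_null (H : ℝ → ℝ) (Y : E3 → ℝ) (x₀ : E3) (hH : ∀ r : ℝ, 0 ≤ r → H r = 0) (x : E3) :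
    sepShellL H Y x₀ x = 0 := by
  have h0 : (fun x : E3 => (H ‖x - x₀‖ * Y (x - x₀)) • (x - x₀)) = fun _ => (0 : E3) := by
    funext x'
    rw [hH ‖x' - x₀‖ (norm_nonneg _), zero_mul, zero_smul]
  show Literature.Analysis.FluidPDE.curl (Literature.Analysis.FluidPDE.curl
    (fun x : E3 => (H ‖x - x₀‖ * Y (x - x₀)) • (x - x₀))) x = 0
  rw [h0, curl_zero_field, curl_zero_field]

/-! ### Compositions (kernel-checked) -/

/-- COMPOSITION S (slice): V ∧ S-V ∧ S-C ∧ S-Z ⇒ separable order-two rigidity in every degree.  The only M–L input is the bridge V; S-C is the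
paper-proved ANGULAR LEMMA; S-V, S-Z are routine. -/
theorem separableOrderTwoRigidityL_of_virial (hV : OrderTwoVirialIdentity) (hN : VirialNondegeneracy)
    (hC : AngularLemma) (hZ : ZonalShellAxisym) : SeparableOrderTwoRigidityL := by
  intro l t₀ T u p x₀ Y H hl hT hsol hp hY hH hu hj2
  have key := hV l t₀ T u p x₀ Y H hl hT hsol hp hY hH hu hj2
  by_cases hm : virialMoment l H = 0
  · have hH0 : ∀ r : ℝ, 0 ≤ r → H r = 0 := hN l H hl hH hm
    apply isSliceAxisymmetric_of_eq_zero
    intro x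
    rw [hu]
    exact sepShellL_null H Y x₀ hH0 x
  · have hA : ∀ ξ : E3, angForm Y ξ = 0 := fun ξ =>
      (mul_eq_zero.mp (key ξ)).resolve_left hm
    rw [hu]
    exact hZ l H Y x₀ hY (hC l Y hY hA) hH

/-- COMPOSITION R (bookkeeping): the window rung is a restriction of the crux — a genuine rung BELOW 27585, for every degree. -/
theorem isotypicWindowRigidityL_of_crux (l n : ℕ)
    (h : Summit.NavierStokesRegularity.NavierStokesRegularity.Theses.UnthreadedRigidityDoor.UnthreadedRigidity) :
    IsotypicWindowRigidityL l n := by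
  intro S hS hconn u x₀ hcont hdiv hmild hbdd hunth hiso
  exact h S hS hconn u x₀ hcont hdiv hmild hbdd hunth

/-- COMPOSITION W (kernel-checked): the WINDOW rung in degree `l ≥ 1` follows from the bridges W, V-W and the supports S-A, S-V, S-C, S-Z, S-U.
No open crux remains on the isotypic class of degree `l` beyond the injectivity input of W (certified `l ≤ 7`). -/
theorem isotypicWindowRigidityL_of_virial (l n : ℕ) (hl : 1 ≤ l) (hWA : WindowWedgeAnalyticL) (hAS : AnalyticWedgeSeparableL)
    (hVW : VirialWindowSilence) (hN : VirialNondegeneracy) (hC : AngularLemma) (hZ : ZonalShellAxisym) (hU : WindowAxisUniform) :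
    IsotypicWindowRigidityL l n := by
  intro S hS hconn u x₀ hcont hdiv hmild hbdd hunth hiso
  obtain ⟨B, cf, hB, hslice⟩ := hiso
  have hsep : ∀ t ∈ S, ∃ (H : ℝ → ℝ) (Y : E3 → ℝ),
      VirialAdmissible l H ∧ IsSolidHarmonic l Y ∧ u t = sepShellL H Y x₀ := by
    intro t ht
    obtain ⟨hW, hA⟩ := hWA l n S hl hS u x₀ hcont hdiv hmild hbdd hunth B cf hB hslice t ht
    obtain ⟨H, Y, hH, hY, hHY⟩ := hAS l n (cf t) B x₀ (hslice t ht).1 hA hW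
    refine ⟨H, Y, hH, hY, ?_⟩
    rw [(hslice t ht).2]
    exact hHY
  choose! Hf Yf hHa hYh hHu using hsep
  have key := hVW l S hl hS u x₀ hcont hdiv hmild hbdd hunth Hf Yf (fun t ht => ⟨hHa t ht, hYh t ht, hHu t ht⟩)
  have hax : ∀ t ∈ S, IsSliceAxisymmetric (u t) x₀ := by
    intro t ht
    by_cases hm : virialMoment l (Hf t) = 0
    · have hH0 : ∀ r : ℝ, 0 ≤ r → Hf t r = 0 := hN l (Hf t) hl (hHa t ht) hm
      apply isSliceAxisymmetric_of_eq_zero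
      intro x
      rw [hHu t ht]
      exact sepShellL_null (Hf t) (Yf t) x₀ hH0 x
    · have hA : ∀ ξ : E3, angForm (Yf t) ξ = 0 := fun ξ =>
        (mul_eq_zero.mp (key t ht ξ)).resolve_left hm
      rw [hHu t ht]
      exact hZ l (Hf t) (Yf t) x₀ (hYh t ht) (hC l (Yf t) (hYh t ht) hA) (hHa t ht)
  exact hU S hS hconn u x₀ hcont hdiv hmild hbdd hax

/-! ### With the supports S-V, S-A, S-Z discharged -/

/-- COMPOSITION S with S-V and S-Z discharged: the BRIDGE V and the ANGULAR LEMMA S-C give separable order-two rigidity in every degree. -/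
theorem separableOrderTwoRigidityL_of_identity (hV : OrderTwoVirialIdentity) (hC : AngularLemma) : SeparableOrderTwoRigidityL :=
  separableOrderTwoRigidityL_of_virial hV virialNondegeneracy_holds hC zonalShellAxisym_holds

/-- COMPOSITION W with S-A, S-V, S-Z discharged: the bridges W, V-W and the S–M supports S-C, S-U give the window rung in degree `l ≥ 1`. -/
theorem isotypicWindowRigidityL_of_bridges (l n : ℕ) (hl : 1 ≤ l) (hWA : WindowWedgeAnalyticL) (hVW : VirialWindowSilence)
    (hC : AngularLemma) (hU : WindowAxisUniform) : IsotypicWindowRigidityL l n :=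
  isotypicWindowRigidityL_of_virial l n hl hWA analyticWedgeSeparableL_holds hVW virialNondegeneracy_holds hC zonalShellAxisym_holds hU

end Summit.NavierStokesRegularity.NavierStokesRegularity.Theorems.UnthreadedRigidity.VirialHorn
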